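import Summits.Ventures.LatticeQCDFlow.Scaling.HaarStartProtocolLaw
import Summits.Ventures.LatticeQCDFlow.TrivializingMaps.CouplingKLAnyGroup

/-!
HONEST FRAMING: exact (Metropolis-corrected) sampling algorithms for lattice gauge theory; figures
of merit are autocorrelation/cost numbers at stated couplings and volumes; no continuum-physics
claim.

# MeanActionFloorSUN — `SU(n)`: THE MEAN PLAQUETTE ACTION DROPS BY AT LEAST `c·#plaq·(arctan b − arctan a)`
# BETWEEN COUPLINGS `a ≤ b`, AND IS AT LEAST `c·#plaq·(π/2 − arctan β) ≥ c·#plaq/(2(1+β))` AT EVERY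
# COUPLING `β ≥ 0`, UNIFORMLY IN THE VOLUME; TWO-SIDED UNIFORM-ANNEALING LAWS WITH POLYNOMIAL CONSTANTS
# (lean-2 GEN-10, ours)

Venture-side (OURS).  Cell `lqcd-flow` (pub-lqcd), unit `pub-lqcd-lean-2-g10`, 2026-08-23.  Integration of
theory2's all-coupling floor (item 129, custody-landed `Scaling/HaarStartProtocolLaw`:
`∃ c = c(n,d) > 0, ∀ L ≥ 2, ∀ u ≥ 0, c·#plaq/(1+u²) ≤ Var_{π_u}(S_W)`, pure `SU(n)`, `n ≥ 2`, `d ≥ 2`)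
along the coupling with the fluctuation relation `⟨S_W⟩_a − ⟨S_W⟩_b = ∫_a^b Var_t dt`
(`AnnealingSufficiencyAnyGroup`) and `∫_a^b dt/(1+t²) = arctan b − arctan a`:

* **`wilson_meanAction_drop_ge_arctan`**: one `c = c(n,d) > 0` with, for every `L ≥ 2` and all
  `0 ≤ a ≤ b`: **`c·#plaq·(arctan b − arctan a) ≤ ⟨S_W⟩_a − ⟨S_W⟩_b`** (`≤ 2n·#plaq` always).
* **`wilson_meanAction_ge`**: same `c`: **`c·#plaq·(π/2 − arctan β) ≤ ⟨S_W⟩_β`** for every `β ≥ 0`, every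
  `L ≥ 2` (let `b → ∞`, `⟨S_W⟩_b ≥ 0`); since `π/2 − arctan β ≥ 1/(2(1+β))` for `β ≥ 0` (it equals
  `∫_β^∞ dt/(1+t²) ≥ ∫_β^∞ dt/(1+t)²/… `; here proved as `arctan β + 1/(2(1+β)) ≤ π/2` by monotonicity),
  **`c·#plaq/(2(1+β)) ≤ ⟨S_W⟩_β`** (`wilson_meanAction_ge_inv`): the MEAN PLAQUETTE ACTION IS AT LEAST
  `c/(2(1+β))` PER PLAQUETTE at every coupling, in every volume — the `1/β` law of lattice perturbation
  theory as a rigorous, volume-uniform FLOOR (with a poor constant).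
* **`wilson_sum_jeffreys_uniform_two_sided`**: along the uniform schedule `β_j = a + jδ` (`a ≥ 0`, `δ ≥ 0`):
  `δ·c·#plaq·(arctan(a+kδ) − arctan a) ≤ Σ_{j<k} J(μ_{β_j}, μ_{β_{j+1}}) ≤ 2n·#plaq·δ` — the symmetrised
  relative entropies of uniform annealing, two-sided with POLYNOMIAL (not exponential) coupling constants.
* **`wilson_uniform_cost_two_sided_allCouplings`**: `c·#plaq·(kδ)²/((1+(a+(k+1)δ)²)·k) ≤ Σ_{j<k} Δ²ψ(β_j;δ)
  ≤ 2n·#plaq·δ` (`a ≥ 0`, `δ ≥ 0`, `k ≥ 1`): the weight-second-moment cost of uniform annealing is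
  `Θ(volume)` at every coupling window with polynomial constants (GEN-10's `uniform_schedule_cost_two_sided`
  had `e^{−cM}`).

NOT CLAIMED: the value of `c` (theory2's existence constant, astronomically small); an upper bound on
`⟨S_W⟩_β` better than `n·#plaq` (equipartition `≈ (n²−1)(d−1)L^d… /β` is theory2's HOME item 124 in the
regime `L ≳ log β`, not here); anything about autocorrelations, flows or the continuum.  Literature grade
(cell rule): corollary; new typing.
-/

noncomputable section

open MeasureTheory ProbabilityTheory Set intervalIntegral InformationTheory Filter Topology
open Literature.MathematicalPhysics.QuantumFieldTheory
open Literature.MathematicalPhysics.QuantumFieldTheory.Luscher2010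
open Literature.MathematicalPhysics.QuantumFieldTheory.WilsonFlow (coeConfig)
open scoped Matrix Matrix.Norms.Frobenius ContDiff

namespace Summit.Ventures.LatticeQCDFlow.TrivializingMaps

section AnyGroup

variable {d L N : ℕ} [NeZero L] {G : Type*} [Group G] [TopologicalSpace G] [IsTopologicalGroup G]
  [CompactSpace G] [MeasurableSpace G] [BorelSpace G] [SecondCountableTopology G]
  (ρ : G →* Matrix (Fin N) (Fin N) ℂ)

/-- **Uniform schedule under a variance floor** (every compact `G`): if `m ≤ Var_u(S_W^ρ)` on
`[a, a+(k+1)δ]` (`δ ≥ 0`) then `k·δ²·m ≤ Σ_{j<k} Δ²ψ(a+jδ; δ)`. [ours] -/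
theorem uniform_schedule_cost_ge_of_floor (hρ : Continuous ρ) (a : ℝ) {δ m : ℝ} (hδ : 0 ≤ δ)
    (k : ℕ) (hm : ∀ u ∈ Icc a (a + (k + 1) * δ), m ≤ variance (wilsonAction (d := d) (L := L) ρ)
      (wilsonMeasure (d := d) (L := L) ρ u)) :
    (k : ℝ) * (δ ^ 2 * m) ≤
      ∑ j ∈ Finset.range k,
        (cgf (fun U => -wilsonAction ρ U) (trivialMeasure G d L) (a + j * δ + 2 * δ) -
          2 * cgf (fun U => -wilsonAction ρ U) (trivialMeasure G d L) (a + j * δ + δ) +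
          cgf (fun U => -wilsonAction ρ U) (trivialMeasure G d L) (a + j * δ)) := by
  have hterm : ∀ j ∈ Finset.range k, δ ^ 2 * m ≤
      cgf (fun U => -wilsonAction ρ U) (trivialMeasure G d L) (a + j * δ + 2 * δ) -
        2 * cgf (fun U => -wilsonAction ρ U) (trivialMeasure G d L) (a + j * δ + δ) +
        cgf (fun U => -wilsonAction ρ U) (trivialMeasure G d L) (a + j * δ) := by
    intro j hj
    have hj' : (j : ℝ) + 1 ≤ k := by exact_mod_cast Nat.succ_le_of_lt (Finset.mem_range.1 hj)
    refine cgf_second_difference_ge_anyGroup (d := d) (L := L) hρ hδ fun u hu => hm u ⟨?_, ?_⟩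
    · have : 0 ≤ (j : ℝ) * δ := by positivity
      linarith [hu.1]
    · have : (j : ℝ) * δ + 2 * δ ≤ (k + 1) * δ := by nlinarith
      linarith [hu.2]
  calc (k : ℝ) * (δ ^ 2 * m) = ∑ _j ∈ Finset.range k, δ ^ 2 * m := by
        rw [Finset.sum_const, Finset.card_range, nsmul_eq_mul]
    _ ≤ _ := Finset.sum_le_sum hterm

end AnyGroup

section SUN

variable {d n : ℕ}

/-- The all-coupling floor of item 129 in the representation spelling: one `c = c(n,d) > 0` with
`c·#plaq/(1+u²) ≤ Var_{wilsonMeasure ρ₀ u}(S_W^{ρ₀})` for every `L ≥ 2`, `u ≥ 0`. [ours] -/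
theorem wilson_variance_floor_allCouplings_rep (hn : 2 ≤ n) (hd : 2 ≤ d) :
    ∃ c : ℝ, 0 < c ∧ ∀ (L : ℕ) [NeZero L], 2 ≤ L → ∀ u : ℝ, 0 ≤ u →
      c * Fintype.card (Plaquette d L) / (1 + u ^ 2) ≤
        variance (wilsonAction (d := d) (L := L) (StrongCoupling.defRep n))
          (wilsonMeasure (d := d) (L := L) (StrongCoupling.defRep n) u) := by
  obtain ⟨c, hc, h⟩ := Theory2.HaarStart.wilson_variance_floor_allCouplings (d := d) (n := n) hn hd
  refine ⟨c, hc, fun L _ hL u hu => ?_⟩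
  have h1 := h L hL u hu
  rwa [Theory2.WilsonSpecificHeat.variance_amb_eq u] at h1

/-- **MEAN-ACTION DROP, ALL COUPLINGS, UNIFORM IN THE VOLUME** (`SU(n)`, `n ≥ 2`, `d ≥ 2`): one
`c = c(n,d) > 0` with `c·#plaq·(arctan b − arctan a) ≤ ⟨S_W⟩_a − ⟨S_W⟩_b` for every `L ≥ 2` and all
`0 ≤ a ≤ b`. [ours] -/
theorem wilson_meanAction_drop_ge_arctan (hn : 2 ≤ n) (hd : 2 ≤ d) :
    ∃ c : ℝ, 0 < c ∧ ∀ (L : ℕ) [NeZero L], 2 ≤ L → ∀ a b : ℝ, 0 ≤ a → a ≤ b →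
      c * Fintype.card (Plaquette d L) * (Real.arctan b - Real.arctan a) ≤
        (∫ U, wilsonAction (StrongCoupling.defRep n) U
            ∂(wilsonMeasure (d := d) (L := L) (StrongCoupling.defRep n) a)) -
          ∫ U, wilsonAction (StrongCoupling.defRep n) U
            ∂(wilsonMeasure (d := d) (L := L) (StrongCoupling.defRep n) b) := by
  obtain ⟨c, hc, h⟩ := wilson_variance_floor_allCouplings_rep (d := d) (n := n) hn hd
  refine ⟨c, hc, fun L _ hL a b ha hab => ?_⟩
  have hρ : Continuous (StrongCoupling.defRep n) := continuous_subtype_val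
  rw [mean_sub_mean_eq_integral_variance (StrongCoupling.defRep n) hρ a b]
  set P : ℝ := (Fintype.card (Plaquette d L) : ℝ) with hP
  have hatan : ∫ u in a..b, c * P * (1 / (1 + u ^ 2)) = c * P * (Real.arctan b - Real.arctan a) := by
    rw [intervalIntegral.integral_const_mul]
    congr 1
    simp
  rw [← hatan]
  have hcont : Continuous fun u : ℝ => c * P * (1 / (1 + u ^ 2)) :=
    continuous_const.mul (continuous_const.div (by fun_prop) fun u => by positivity)
  refine intervalIntegral.integral_mono_on hab (hcont.intervalIntegrable _ _)
    ((continuous_variance_wilsonMeasure hρ).intervalIntegrable _ _) fun u hu => ?_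
  have h1 := h L hL u (ha.trans hu.1)
  rw [mul_one_div]
  exact h1

/-- **MEAN-ACTION FLOOR AT EVERY COUPLING** (`SU(n)`, `n ≥ 2`, `d ≥ 2`): with the same `c`,
`c·#plaq·(π/2 − arctan β) ≤ ⟨S_W⟩_β` for every `β ≥ 0` and every `L ≥ 2`. [ours] -/
theorem wilson_meanAction_ge (hn : 2 ≤ n) (hd : 2 ≤ d) :
    ∃ c : ℝ, 0 < c ∧ ∀ (L : ℕ) [NeZero L], 2 ≤ L → ∀ β : ℝ, 0 ≤ β →
      c * Fintype.card (Plaquette d L) * (Real.pi / 2 - Real.arctan β) ≤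
        ∫ U, wilsonAction (StrongCoupling.defRep n) U
          ∂(wilsonMeasure (d := d) (L := L) (StrongCoupling.defRep n) β) := by
  obtain ⟨c, hc, h⟩ := wilson_meanAction_drop_ge_arctan (d := d) (n := n) hn hd
  refine ⟨c, hc, fun L _ hL β hβ => ?_⟩
  have hρ : Continuous (StrongCoupling.defRep n) := continuous_subtype_val
  set P : ℝ := (Fintype.card (Plaquette d L) : ℝ) with hP
  set E : ℝ → ℝ := fun t => ∫ U, wilsonAction (StrongCoupling.defRep n) U
    ∂(wilsonMeasure (d := d) (L := L) (StrongCoupling.defRep n) t) with hE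
  -- for every `b ≥ β`: `c P (arctan b − arctan β) ≤ E β − E b ≤ E β`
  have hb : ∀ b : ℝ, β ≤ b → c * P * (Real.arctan b - Real.arctan β) ≤ E β := by
    intro b hbb
    have h1 := h L hL β b hβ hbb
    have h2 : 0 ≤ E b := mean_wilsonAction_nonneg (d := d) (L := L) (StrongCoupling.defRep n) hρ b
    simp only [hE] at h2 ⊢
    linarith
  -- let `b → ∞`
  have hlim : Tendsto (fun b : ℝ => c * P * (Real.arctan b - Real.arctan β)) atTop
      (𝓝 (c * P * (Real.pi / 2 - Real.arctan β))) :=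
    ((Real.tendsto_arctan_atTop.mono_right nhdsWithin_le_nhds).sub_const _).const_mul _
  exact le_of_tendsto hlim (Filter.eventually_atTop.2 ⟨β, fun b hbb => hb b hbb⟩)

/-- `arctan β + 1/(2(1+β)) ≤ π/2` for `β ≥ 0` (both sides agree at `∞`; the left side is increasing
since `(arctan β + 1/(2(1+β)))′ = 1/(1+β²) − 1/(2(1+β)²) ≥ 0`). [folklore] -/
theorem arctan_add_inv_le_pi_div_two {β : ℝ} (hβ : 0 ≤ β) :
    Real.arctan β + 1 / (2 * (1 + β)) ≤ Real.pi / 2 := by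
  -- `g(x) = arctan x + 1/(2(1+x))` is monotone on `[0, ∞)` and tends to `π/2`
  set g : ℝ → ℝ := fun x => Real.arctan x + 1 / (2 * (1 + x)) with hg
  have hderiv : ∀ x : ℝ, 0 ≤ x → HasDerivAt g (1 / (1 + x ^ 2) - 1 / (2 * (1 + x) ^ 2)) x := by
    intro x hx
    have h1 := Real.hasDerivAt_arctan x
    have h2 : HasDerivAt (fun y : ℝ => 1 / (2 * (1 + y))) (-(2 * 1) / (2 * (1 + x)) ^ 2) x := by
      have h3 : HasDerivAt (fun y : ℝ => 2 * (1 + y)) (2 * 1) x :=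
        ((hasDerivAt_id x).const_add 1).const_mul 2 |>.congr_deriv (by simp)
      exact (hasDerivAt_const x (1 : ℝ)).div h3 (by positivity) |>.congr_deriv (by simp)
    have h12 := h1.add h2
    refine h12.congr_deriv ?_
    field_simp
    ring
  have hmono : MonotoneOn g (Ici 0) := by
    refine monotoneOn_of_deriv_nonneg (convex_Ici 0) ?_ ?_ ?_
    · exact fun x hx => (hderiv x hx).continuousAt.continuousWithinAt
    · intro x hx
      rw [interior_Ici] at hx
      exact (hderiv x (le_of_lt hx)).differentiableAt.differentiableWithinAt
    · intro x hx
      rw [interior_Ici] at hx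
      have hx0 : 0 ≤ x := le_of_lt hx
      rw [(hderiv x hx0).deriv]
      rw [sub_nonneg, div_le_div_iff₀ (by positivity) (by positivity)]
      nlinarith [sq_nonneg (x - 1), hx0]
  have hlim : Tendsto g atTop (𝓝 (Real.pi / 2 + 0)) := by
    refine (Real.tendsto_arctan_atTop.mono_right nhdsWithin_le_nhds).add ?_
    have h1 : Tendsto (fun x : ℝ => 2 * (1 + x)) atTop atTop :=
      Filter.Tendsto.const_mul_atTop two_pos (tendsto_atTop_add_const_left _ 1 tendsto_id)
    refine h1.inv_tendsto_atTop.congr' (Filter.Eventually.of_forall fun x => ?_)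
    simp only [Pi.inv_apply, one_div]
  rw [add_zero] at hlim
  -- `g β ≤ g b` for all `b ≥ β`, and `g b → π/2`
  have hev : ∀ᶠ b in atTop, g β ≤ g b :=
    Filter.eventually_atTop.2 ⟨β, fun b hbb => hmono (mem_Ici.2 hβ) (mem_Ici.2 (hβ.trans hbb)) hbb⟩
  exact ge_of_tendsto hlim hev

/-- **`⟨S_W⟩_β ≥ c·#plaq/(2(1+β))`** for every `β ≥ 0`, every `L ≥ 2` (`SU(n)`, `n ≥ 2`, `d ≥ 2`): the
mean Wilson action per plaquette is at least `c/(2(1+β))` — the `1/β` law as a volume-uniform floor.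
[ours] -/
theorem wilson_meanAction_ge_inv (hn : 2 ≤ n) (hd : 2 ≤ d) :
    ∃ c : ℝ, 0 < c ∧ ∀ (L : ℕ) [NeZero L], 2 ≤ L → ∀ β : ℝ, 0 ≤ β →
      c * Fintype.card (Plaquette d L) / (2 * (1 + β)) ≤
        ∫ U, wilsonAction (StrongCoupling.defRep n) U
          ∂(wilsonMeasure (d := d) (L := L) (StrongCoupling.defRep n) β) := by
  obtain ⟨c, hc, h⟩ := wilson_meanAction_ge (d := d) (n := n) hn hd
  refine ⟨c, hc, fun L _ hL β hβ => le_trans ?_ (h L hL β hβ)⟩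
  have hP : (0 : ℝ) ≤ c * Fintype.card (Plaquette d L) := by positivity
  have h1 := arctan_add_inv_le_pi_div_two hβ
  calc c * Fintype.card (Plaquette d L) / (2 * (1 + β))
      = c * Fintype.card (Plaquette d L) * (1 / (2 * (1 + β))) := by rw [mul_one_div]
    _ ≤ c * Fintype.card (Plaquette d L) * (Real.pi / 2 - Real.arctan β) :=
        mul_le_mul_of_nonneg_left (by linarith) hP

/-- **JEFFREYS SUM OF UNIFORM ANNEALING, TWO-SIDED, POLYNOMIAL CONSTANTS** (`SU(n)`, `n ≥ 2`, `d ≥ 2`):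
one `c` with, for every `L ≥ 2`, `a ≥ 0`, `δ ≥ 0`, `k`:
`δ·c·#plaq·(arctan(a+kδ) − arctan a) ≤ Σ_{j<k} [D(μ_{β_j}‖μ_{β_{j+1}}) + D(μ_{β_{j+1}}‖μ_{β_j})] ≤ 2n·#plaq·δ`
(`β_j = a + jδ`). [ours] -/
theorem wilson_sum_jeffreys_uniform_two_sided (hn : 2 ≤ n) (hd : 2 ≤ d) :
    ∃ c : ℝ, 0 < c ∧ ∀ (L : ℕ) [NeZero L], 2 ≤ L → ∀ a δ : ℝ, 0 ≤ a → 0 ≤ δ → ∀ k : ℕ,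
      δ * (c * Fintype.card (Plaquette d L) * (Real.arctan (a + k * δ) - Real.arctan a)) ≤
        ∑ j ∈ Finset.range k,
          ((klDiv (wilsonMeasure (d := d) (L := L) (StrongCoupling.defRep n) (a + j * δ))
              (wilsonMeasure (d := d) (L := L) (StrongCoupling.defRep n) (a + (j + 1) * δ))).toReal +
            (klDiv (wilsonMeasure (d := d) (L := L) (StrongCoupling.defRep n) (a + (j + 1) * δ))
              (wilsonMeasure (d := d) (L := L) (StrongCoupling.defRep n) (a + j * δ))).toReal) ∧
      ∑ j ∈ Finset.range k,
          ((klDiv (wilsonMeasure (d := d) (L := L) (StrongCoupling.defRep n) (a + j * δ))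
              (wilsonMeasure (d := d) (L := L) (StrongCoupling.defRep n) (a + (j + 1) * δ))).toReal +
            (klDiv (wilsonMeasure (d := d) (L := L) (StrongCoupling.defRep n) (a + (j + 1) * δ))
              (wilsonMeasure (d := d) (L := L) (StrongCoupling.defRep n) (a + j * δ))).toReal) ≤
        2 * n * Fintype.card (Plaquette d L) * δ := by
  obtain ⟨c, hc, h⟩ := wilson_meanAction_drop_ge_arctan (d := d) (n := n) hn hd
  refine ⟨c, hc, fun L _ hL a δ ha hδ k => ⟨?_, ?_⟩⟩
  · have hρ : Continuous (StrongCoupling.defRep n) := continuous_subtype_val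
    rw [sum_jeffreys_uniform (StrongCoupling.defRep n) hρ a δ k]
    have hk : a ≤ a + k * δ := by
      have : (0 : ℝ) ≤ k * δ := by positivity
      linarith
    exact mul_le_mul_of_nonneg_left (h L hL a (a + k * δ) ha hk) hδ
  · exact sum_jeffreys_uniform_le_volume (StrongCoupling.defRep n) continuous_subtype_val a hδ k

/-- **UNIFORM ANNEALING COST, TWO-SIDED AT EVERY COUPLING WINDOW, POLYNOMIAL CONSTANTS** (`SU(n)`,
`n ≥ 2`, `d ≥ 2`): one `c` with, for every `L ≥ 2`, `a ≥ 0`, `δ ≥ 0`, `k ≥ 1`: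
`c·#plaq·(kδ)²/((1 + (a+(k+1)δ)²)·k) ≤ Σ_{j<k} Δ²ψ(a+jδ; δ) ≤ 2n·#plaq·δ`. [ours] -/
theorem wilson_uniform_cost_two_sided_allCouplings (hn : 2 ≤ n) (hd : 2 ≤ d) :
    ∃ c : ℝ, 0 < c ∧ ∀ (L : ℕ) [NeZero L], 2 ≤ L → ∀ a δ : ℝ, 0 ≤ a → 0 ≤ δ → ∀ k : ℕ, 1 ≤ k →
      c * Fintype.card (Plaquette d L) * (k * δ) ^ 2 / ((1 + (a + (k + 1) * δ) ^ 2) * k) ≤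
        ∑ j ∈ Finset.range k,
          (cgf (fun U => -wilsonAction (StrongCoupling.defRep n) U)
              (trivialMeasure (Matrix.specialUnitaryGroup (Fin n) ℂ) d L) (a + j * δ + 2 * δ) -
            2 * cgf (fun U => -wilsonAction (StrongCoupling.defRep n) U)
              (trivialMeasure (Matrix.specialUnitaryGroup (Fin n) ℂ) d L) (a + j * δ + δ) +
            cgf (fun U => -wilsonAction (StrongCoupling.defRep n) U)
              (trivialMeasure (Matrix.specialUnitaryGroup (Fin n) ℂ) d L) (a + j * δ)) ∧
      ∑ j ∈ Finset.range k,
          (cgf (fun U => -wilsonAction (StrongCoupling.defRep n) U)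
              (trivialMeasure (Matrix.specialUnitaryGroup (Fin n) ℂ) d L) (a + j * δ + 2 * δ) -
            2 * cgf (fun U => -wilsonAction (StrongCoupling.defRep n) U)
              (trivialMeasure (Matrix.specialUnitaryGroup (Fin n) ℂ) d L) (a + j * δ + δ) +
            cgf (fun U => -wilsonAction (StrongCoupling.defRep n) U)
              (trivialMeasure (Matrix.specialUnitaryGroup (Fin n) ℂ) d L) (a + j * δ)) ≤
        2 * n * Fintype.card (Plaquette d L) * δ := by
  obtain ⟨c, hc, h⟩ := wilson_variance_floor_allCouplings_rep (d := d) (n := n) hn hd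
  refine ⟨c, hc, fun L _ hL a δ ha hδ k hk => ⟨?_, ?_⟩⟩
  · have hρ : Continuous (StrongCoupling.defRep n) := continuous_subtype_val
    set P : ℝ := (Fintype.card (Plaquette d L) : ℝ) with hP
    set B : ℝ := a + (k + 1) * δ with hB
    set m : ℝ := c * P / (1 + B ^ 2) with hm
    have hm0 : 0 ≤ m := by positivity
    -- the floor `m` on `[a, B]`: `c P/(1+u²) ≥ c P/(1+B²)` for `0 ≤ u ≤ B`
    have hfloor : ∀ u ∈ Icc a B, m ≤ variance (wilsonAction (d := d) (L := L) (StrongCoupling.defRep n))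
        (wilsonMeasure (d := d) (L := L) (StrongCoupling.defRep n) u) := by
      intro u hu
      have hu0 : 0 ≤ u := ha.trans hu.1
      refine le_trans ?_ (h L hL u hu0)
      rw [hm]
      exact div_le_div_of_nonneg_left (by positivity) (by positivity)
        (by nlinarith [hu.2, hu0, sq_nonneg (B - u)])
    have hmain := uniform_schedule_cost_ge_of_floor (d := d) (L := L) (StrongCoupling.defRep n) hρ a hδ
      k hfloor
    have hk0 : (k : ℝ) ≠ 0 := by
      have : (1 : ℝ) ≤ k := by exact_mod_cast hk
      positivity
    have h1B : (1 + B ^ 2) ≠ 0 := by positivity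
    have heq : c * P * (k * δ) ^ 2 / ((1 + B ^ 2) * k) = k * (δ ^ 2 * m) := by
      rw [hm]
      field_simp
    rw [heq]
    exact hmain
  · exact uniform_schedule_cost_le_volume (StrongCoupling.defRep n) continuous_subtype_val a hδ k

end SUN

end Summit.Ventures.LatticeQCDFlow.TrivializingMaps

end
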